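import Summits.BirchSwinnertonDyer.Rank1Residual.X11b.BDPRouteUpperLinksFieldAll
import Summits.BirchSwinnertonDyer.Rank1Residual.X11b.LocalTorsionMultiplicative
import HarnessLib

/-!
# Class X11b at `p = 3` (team N8/O2, cell `b2b-bsdres`): the Shimura links' Tamagawa bookkeeping at an ODD prime `p`, part 1 — the multiplicative primes (sub-target T-O2-T2B@3)

HONEST FRAMING (verbatim, cell `b2b-bsdres`, run/shared/lean/b2b/bsd-rank1-residual/): the goal of
the cell is to DELETE the COMBINATION-SHAPED residual classes for ALL analytic-rank `≤ 1` curves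
over `ℚ` — "full BSD formula for every rank `≤ 1` curve in class `C`" assembled STRICTLY from
published theorems — so that the rank-`≤ 1` remainder becomes exactly the CONSTRUCTION-SHAPED
classes, which are TYPED (missing-input Props), NOT attempted; this is not "finishing BSD".
Research route for class X11b (`ClassX11b W p := r_an = 1 ∧ p ≠ 2 ∧ mult(p) ∧ irr(p)`) at the prime
`p = 3`; no claim beyond the stated class and sub-population; nothing booked; X11 ∧ `r = 1` at
`p = 3` stays CONSTRUCTION-SHAPED (REFEREE R6.2). THEOREMS ONLY (no definition, no named fact, no
`sorry`); elementary local arithmetic (Kodaira–Néron), no announced result involved.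

## What this file does

The route p2 of sub-cell `multr1-p2` reduces, for `p ≥ 5`, the Euler-system half
`Typed.MissingUpperBoundAt W p` on the Tamagawa atom (T2′) = (ram) ∧ `p ∣ ∏c_ℓ(E)` off the sub-shape
(T2α) (`E` split multiplicative at `p` with `p ∣ ord_p Δ_min`) to the two Shimura-curve displays of
Jetchev–Skinner–Wan 2017 §7.4.2 at a Friedberg–Hoffstein field `K″` in which the primes `ℓ ≠ p`
carrying a `p`-divisible Tamagawa number are INERT (`BDPRouteUpperLinks` → `UpperLinksInert` /
`InertTwo` → `UpperLinksField` / `FieldAll` → `UpperField`). The hypothesis `5 ≤ p` of that chain is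
load-bearing in exactly four local lemmas, each through "`0 < c_ℓ ≤ 4 < p`" (Kodaira–Néron, ATAEC
IV.9.2(d)): `padicValNat_localTamagawaNumber_add_twist_le_of_inert`, `…_of_inert_two`,
`…_eq_zero_of_good`, `…_eq_zero_of_isSquare`. At `p = 3` the bound `c ≤ 4` does not exclude `c = 3`;
what does, at a MULTIPLICATIVE prime, is the finer printed value: non-split `Iₙ` has `c ∈ {1, 2}`
(ATAEC IV.9.4 Step 2; tree theorem `localTamagawaNumber_of_hasNonsplitMultiplicativeReductionAt_holds`,
moved to Mathlib's `ℚ_[ℓ]` by `localTamagawaNumber_padic_eq_holds` and `LocalTorsion.exists_place_of_mult`).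
This file (part 1 of 2; part 2 = `UpperHalfLocal.lean`: good and split primes, the sum) proves,
for every `p ≠ 2`:

* `not_dvd_localTamagawaNumber_of_mult`, `padicValNat_localTamagawaNumber_eq_zero_of_mult` —
  `p ∤ c_ℓ(E)` at a multiplicative `ℓ` that is non-split or has `p ∤ ord_ℓ Δ_min` (`p ≥ 3`, any `ℓ`);
* `split_twist_iff_not_split_of_jacobiSym` — at an odd inert multiplicative `ℓ` exactly one of
  `E`, `E^{d_K}` is split (the first half of multr1-p2's inert lemma, isolated);
* `padicValNat_localTamagawaNumber_add_twist_le_of_inert_odd`, `…_of_inert_two_odd` — at an inert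
  multiplicative prime (`ℓ` odd with `(d_K/ℓ) = −1`, resp. `ℓ = 2` with `d_K ≡ 5 mod 8`) the two
  Tamagawa exponents of `E`, `E^{d_K}` add up to `≤ ord_p(ord_ℓ Δ_min(E))` — the cancellation
  "`c_ℓ(E)·c_ℓ(E^D)` versus `c_w(E/K″) = ord_ℓ Δ`" at `ℓ ∣ N⁻` of JSW §7.3.1/§7.4.2, now at `p = 3`.

CONDITIONAL theorems downstream; nothing booked; labels unchanged.

References: [SilvermanATAEC1994] Cor. IV.9.2 (b),(d) (PDF p. 340), IV.9.4 Step 2 (PDF p. 344);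
[SilvermanAEC2009] VII.1 Prop. 1.3, VII.5 Prop. 5.1, App. A Prop. A.1.1; [JetchevSkinnerWan2017]
§7.3.1 (eq:tamK), §7.4.2 (p. 31).
-/

noncomputable section

open scoped Classical

open WeierstrassCurve NumberField IsDedekindDomain Literature.NumberTheory.EllipticCurves
  Rat.HeightOneSpectrum
  Literature.NumberTheory.EllipticCurves.Rank1Residual
  Literature.NumberTheory.EllipticCurves.Rank1Residual.Typed
  Literature.NumberTheory.EllipticCurves.ModularForms

namespace Summit.BirchSwinnertonDyer.Rank1Residual.X11b.Three

/-! ### A multiplicative prime: `p ∤ c_ℓ` unless split with `p ∣ ord_ℓ Δ_min` -/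

section Mult

variable (W : WeierstrassCurve ℚ) [W.IsElliptic] [W.IsGloballyMinimal] (p : ℕ) (ℓ : ℕ) [Fact ℓ.Prime]

/-- **`p ∤ c_ℓ(E)` at a multiplicative prime `ℓ` that is non-split or has `p ∤ ord_ℓ Δ_min(E)`**,
for every `p ≥ 3` and EVERY prime `ℓ` (Kodaira–Néron: `c_ℓ = ord_ℓ Δ_min` in the split case,
`c_ℓ ∈ {1, 2}` in the non-split case — Silverman *ATAEC* IV.9.4 Step 2; the tree theorems
`kodairaNeron_localTamagawaNumber` and `localTamagawaNumber_of_hasNonsplitMultiplicativeReductionAt_holds`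
at the place `v ∣ ℓ` of `𝓞 ℚ`, moved to Mathlib's `ℚ_[ℓ]` by `localTamagawaNumber_padic_eq_holds`).
The sibling's `LocalTorsion.not_dvd_localTamagawaNumber_padic_of_mult` is the case `ℓ = p`.
[cite: SilvermanATAEC1994, IV.9.4 Step 2 (PDF p. 344) and Cor. IV.9.2(d) (PDF p. 340)] -/
theorem not_dvd_localTamagawaNumber_of_mult (hp3 : 3 ≤ p) (hmult : Mult W ℓ)
    (h : ¬ W.HasSplitMultiplicativeReductionAtPrime ℓ ∨
      ¬ p ∣ padicValInt ℓ W.minimalDiscriminantInt) :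
    ¬ p ∣ (W.baseChange ℚ_[ℓ]).localTamagawaNumber ℤ_[ℓ] := by
  obtain ⟨v, hvp, hmultv, hsplit⟩ := LocalTorsion.exists_place_of_mult W ℓ hmult
  haveI : Finite (IsLocalRing.ResidueField (v.adicCompletionIntegers ℚ)) :=
    HeightOneSpectrum.finite_residueField_adicCompletionIntegers ℚ v
  rw [localTamagawaNumber_padic_eq_holds W v ℓ hvp]
  by_cases hs : W.HasSplitMultiplicativeReductionAt v
  · -- split: `c = ord_v(Δ_min) = ord_ℓ(Δ_min)`, and `p ∤` it by hypothesis
    have hns : ¬ p ∣ padicValInt ℓ W.minimalDiscriminantInt := by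
      rcases h with h | h
      · exact absurd (hsplit.mpr hs) h
      · exact h
    rw [(kodairaNeron_localTamagawaNumber W v).2.1 hs, ordMinimalDiscriminant_eq_padicValInt W v hvp]
    exact hns
  · -- non-split: `c ∈ {1, 2}`
    rw [localTamagawaNumber_of_hasNonsplitMultiplicativeReductionAt_holds v W hmultv hs]
    intro hd
    split_ifs at hd
    · have := Nat.le_of_dvd two_pos hd; omega
    · have := Nat.le_of_dvd one_pos hd; omega

/-- `ord_p c_ℓ(E) = 0` at a multiplicative prime `ℓ` that is non-split or has `p ∤ ord_ℓ Δ_min(E)`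
(`p ≥ 3`; valuation form of `not_dvd_localTamagawaNumber_of_mult`).
[cite: SilvermanATAEC1994, IV.9.4 Step 2 (PDF p. 344) and Cor. IV.9.2(d) (PDF p. 340)] -/
theorem padicValNat_localTamagawaNumber_eq_zero_of_mult (hp3 : 3 ≤ p) (hmult : Mult W ℓ)
    (h : ¬ W.HasSplitMultiplicativeReductionAtPrime ℓ ∨
      ¬ p ∣ padicValInt ℓ W.minimalDiscriminantInt) :
    padicValNat p ((W.baseChange ℚ_[ℓ]).localTamagawaNumber ℤ_[ℓ]) = 0 :=
  padicValNat.eq_zero_of_not_dvd (not_dvd_localTamagawaNumber_of_mult W p ℓ hp3 hmult h)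

end Mult

/-! ### An odd inert multiplicative prime: exactly one of `E`, `E^{d_K}` is split -/

section Inert

variable (W : WeierstrassCurve ℚ) [W.IsElliptic] [W.IsGloballyMinimal]
  (K : Type) [Field K] [NumberField K]
  {Wd : WeierstrassCurve ℚ} [Wd.IsElliptic] [Wd.IsGloballyMinimal] (Cd : VariableChange ℚ)
  (hWd : Cd • W.quadraticTwist (NumberField.discr K : ℚ) = Wd)
  (ℓ : ℕ) [Fact ℓ.Prime] (hℓ2 : ℓ ≠ 2) (hJ : jacobiSym (NumberField.discr K) ℓ = -1)

include hWd hℓ2 hJ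

omit [Wd.IsElliptic] [Wd.IsGloballyMinimal] in
/-- **At an odd inert multiplicative prime, `E^{d_K}` is split multiplicative iff `E` is not.**
`d_K` is a non-square `ℓ`-adic unit (`(d_K/ℓ) = −1`), the twist `(E ⊗ ℚ_ℓ)^{(d_K)}` of the
`ℤ_ℓ`-minimal equation is again minimal (`isMinimal_quadraticTwist`, `2 ∈ ℤ_ℓ^×`), and the
node-tangent discriminant is multiplied by `d_K⁵` (`hasSplitMultiplicativeReduction_quadraticTwist_iff`);
split multiplicative reduction does not depend on the minimal equation
(`hasSplitMultiplicativeReduction_iff_of_isMinimal_of_eq_smul`, Silverman *AEC* VII.5 Prop. 5.1(b)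
with VII.1 Prop. 1.3(b)). This is the first half of multr1-p2's
`padicValNat_localTamagawaNumber_add_twist_le_of_inert`, isolated so that the odd-prime Tamagawa
bound below can replace its "`c ≤ 4 < p`" step. [cite: SilvermanAEC2009, VII.5 Prop. 5.1(b) and VII.1 Prop. 1.3(b)] -/
theorem split_twist_iff_not_split_of_jacobiSym (hmult : Mult W ℓ) :
    Wd.HasSplitMultiplicativeReductionAtPrime ℓ ↔ ¬ W.HasSplitMultiplicativeReductionAtPrime ℓ := by
  set d : ℤ := NumberField.discr K with hd_def
  have hℓd : ¬ (ℓ : ℤ) ∣ d := not_dvd_of_jacobiSym_eq_neg_one hJ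
  have hd0 : d ≠ 0 := by rw [hd_def]; exact NumberField.discr_ne_zero K
  have hD0 : (d : ℚ) ≠ 0 := by exact_mod_cast hd0
  haveI : (W.quadraticTwist (d : ℚ)).IsElliptic := W.isElliptic_quadraticTwist hD0
  haveI : (W.baseChange ℚ_[ℓ]).IsElliptic := inferInstanceAs (W.map (algebraMap ℚ ℚ_[ℓ])).IsElliptic
  haveI := finite_residueField_padicInt ℓ
  set u : ℤ_[ℓ]ˣ := (isUnit_intCast_padicInt_of_not_dvd hℓd).unit with hu_def
  have hu : (u : ℤ_[ℓ]) = (d : ℤ_[ℓ]) := rfl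
  have hu' : algebraMap ℤ_[ℓ] ℚ_[ℓ] (u : ℤ_[ℓ]) = algebraMap ℚ ℚ_[ℓ] (d : ℚ) := by
    rw [hu]; simp
  have hnsq : ¬ IsSquare (IsLocalRing.residue ℤ_[ℓ] (u : ℤ_[ℓ])) := by
    rw [hu]; exact not_isSquare_residue_of_jacobiSym_eq_neg_one hJ
  set X : WeierstrassCurve ℚ_[ℓ] := W.baseChange ℚ_[ℓ] with hX
  set Y : WeierstrassCurve ℚ_[ℓ] := Wd.baseChange ℚ_[ℓ] with hY
  haveI hXmin : X.IsMinimal ℤ_[ℓ] := isMinimal_map_padic_of_isGloballyMinimal W ℓ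
  set Y' : WeierstrassCurve ℚ_[ℓ] := X.quadraticTwist (algebraMap ℤ_[ℓ] ℚ_[ℓ] (u : ℤ_[ℓ])) with hY'
  haveI hY'min : Y'.IsMinimal ℤ_[ℓ] := isMinimal_quadraticTwist ℤ_[ℓ] X (isUnit_two_padicInt hℓ2) u
  have hX0 : X.Δ ≠ 0 := by
    rw [hX, baseChange, map_Δ, ← cast_minimalDiscriminantInt W, map_intCast]
    exact_mod_cast minimalDiscriminantInt_ne_zero W
  have hY'0 : Y'.Δ ≠ 0 := by
    rw [hY', quadraticTwist_Δ]
    exact mul_ne_zero (pow_ne_zero 6 (by rw [hu']; exact (map_ne_zero _).mpr hD0)) hX0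
  -- `Y = Cd • Y'`
  have hYY' : Y = Cd.map (algebraMap ℚ ℚ_[ℓ]) • Y' := by
    rw [hY, ← hWd, WeierstrassCurve.VariableChange.baseChange_smul_eq (W.quadraticTwist (d : ℚ)) Cd
      ℚ_[ℓ], baseChange, map_quadraticTwist, ← hu', hY', hX, baseChange]
  -- the chosen minimal models
  obtain ⟨C₁, hC₁⟩ : ∃ C : VariableChange ℚ_[ℓ], X.minimal ℤ_[ℓ] = C • X := ⟨_, rfl⟩
  obtain ⟨C₂, hC₂⟩ : ∃ C : VariableChange ℚ_[ℓ], Y.minimal ℤ_[ℓ] = C • Y := ⟨_, rfl⟩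
  have hC₂' : Y.minimal ℤ_[ℓ] = (C₂ * Cd.map (algebraMap ℚ ℚ_[ℓ])) • Y' := by
    rw [hC₂, hYY', mul_smul]
  -- `X` is multiplicative; the twist criterion
  have hXmult : X.HasMultiplicativeReduction ℤ_[ℓ] :=
    (hasMultiplicativeReduction_iff_of_isMinimal_of_eq_smul ℤ_[ℓ] hC₁ hX0).mp hmult
  have hsplit : Y'.HasSplitMultiplicativeReduction ℤ_[ℓ] ↔
      ¬ X.HasSplitMultiplicativeReduction ℤ_[ℓ] := by
    rw [hasSplitMultiplicativeReduction_quadraticTwist_iff ℤ_[ℓ] (isUnit_two_padicInt hℓ2) hXmult]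
    constructor
    · intro h hXs; exact hnsq (h.mpr hXs)
    · intro h; exact ⟨fun hs ↦ absurd hs hnsq, fun hs ↦ absurd hs h⟩
  have hXs_iff : W.HasSplitMultiplicativeReductionAtPrime ℓ ↔ X.HasSplitMultiplicativeReduction ℤ_[ℓ] :=
    hasSplitMultiplicativeReduction_iff_of_isMinimal_of_eq_smul ℤ_[ℓ] hC₁ hX0
  have hYs_iff : Wd.HasSplitMultiplicativeReductionAtPrime ℓ ↔
      Y'.HasSplitMultiplicativeReduction ℤ_[ℓ] :=
    hasSplitMultiplicativeReduction_iff_of_isMinimal_of_eq_smul ℤ_[ℓ] hC₂' hY'0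
  rw [hYs_iff, hsplit, hXs_iff]

/-- **At an odd inert multiplicative prime the two Tamagawa exponents add up to at most
`ord_p(ord_ℓ Δ_min(E))`, for every ODD `p`** (`p = 3` included). Exactly one of `E`, `E^{d_K}` is
split multiplicative at `ℓ` (`split_twist_iff_not_split_of_jacobiSym`), both are multiplicative with
`ord_ℓ Δ_min(E^{d_K}) = ord_ℓ Δ_min(E)` (`mult_twist_of_jacobiSym`,
`padicValInt_minimalDiscriminantInt_twist_eq_of_jacobiSym`); the split one has
`c_ℓ = ord_ℓ Δ_min(E)` (Kodaira–Néron IV.9.2(d), `localTamagawaNumber_eq_padicValInt_of_split`), the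
NON-SPLIT one has `c_ℓ ∈ {1, 2}`, prime to `p ≥ 3` (`padicValNat_localTamagawaNumber_eq_zero_of_mult`)
— this replaces the step "`c ≤ 4 < p`" of multr1-p2's `padicValNat_localTamagawaNumber_add_twist_le_of_inert`
(`p ≥ 5`). The cancellation "`c_ℓ(E)·c_ℓ(E^D)` versus `c_w(E/K″) = ord_ℓ Δ`" at a prime `ℓ ∣ N⁻` of
Jetchev–Skinner–Wan 2017 §7.3.1/§7.4.2. [cite: SilvermanATAEC1994, Cor. IV.9.2(d) with (b) (PDF p. 340) and IV.9.4 Step 2 (PDF p. 344)]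
[cite: JetchevSkinnerWan2017, §7.3.1 (eq:tamK) and §7.4.2 (p. 31)] -/
theorem padicValNat_localTamagawaNumber_add_twist_le_of_inert_odd (p : ℕ) [Fact p.Prime]
    (hp2 : p ≠ 2) (hmult : Mult W ℓ) :
    padicValNat p ((W.baseChange ℚ_[ℓ]).localTamagawaNumber ℤ_[ℓ]) +
        padicValNat p ((Wd.baseChange ℚ_[ℓ]).localTamagawaNumber ℤ_[ℓ]) ≤
      padicValNat p (padicValInt ℓ W.minimalDiscriminantInt) := by
  have hp3 : 3 ≤ p := by
    have := (Fact.out : p.Prime).two_le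
    omega
  have hswap := split_twist_iff_not_split_of_jacobiSym W K Cd hWd ℓ hℓ2 hJ hmult
  have hmultd : Mult Wd ℓ := mult_twist_of_jacobiSym W K Cd hWd ℓ hℓ2 hJ hmult
  have hΔ : padicValInt ℓ Wd.minimalDiscriminantInt = padicValInt ℓ W.minimalDiscriminantInt :=
    padicValInt_minimalDiscriminantInt_twist_eq_of_jacobiSym W K Cd hWd ℓ hℓ2 hJ
  obtain ⟨v, hv⟩ : ∃ v : HeightOneSpectrum ℤ, (primesEquiv v : ℕ) = ℓ :=
    ⟨primesEquiv.symm ⟨ℓ, Fact.out⟩, by rw [Equiv.apply_symm_apply]⟩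
  by_cases hWs : W.HasSplitMultiplicativeReductionAtPrime ℓ
  · -- `W` split at `ℓ`, `Wd` non-split
    have hWdns : ¬ Wd.HasSplitMultiplicativeReductionAtPrime ℓ := fun hs ↦ (hswap.mp hs) hWs
    rw [padicValNat_localTamagawaNumber_eq_zero_of_mult Wd p ℓ hp3 hmultd (Or.inl hWdns), add_zero,
      localTamagawaNumber_eq_padicValInt_of_split W v hv hWs]
  · -- `W` non-split at `ℓ`, `Wd` split
    have hWds : Wd.HasSplitMultiplicativeReductionAtPrime ℓ := hswap.mpr hWs
    rw [padicValNat_localTamagawaNumber_eq_zero_of_mult W p ℓ hp3 hmult (Or.inl hWs), zero_add,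
      localTamagawaNumber_eq_padicValInt_of_split Wd v hv hWds, hΔ]

end Inert

/-! ### The inert prime `2` (`d_K ≡ 5 mod 8`) -/

section InertTwo

variable (W : WeierstrassCurve ℚ) [W.IsElliptic] [W.IsGloballyMinimal]
  (K : Type) [Field K] [NumberField K]
  {Wd : WeierstrassCurve ℚ} [Wd.IsElliptic] [Wd.IsGloballyMinimal] (Cd : VariableChange ℚ)
  (hWd : Cd • W.quadraticTwist (NumberField.discr K : ℚ) = Wd)
  (h8 : NumberField.discr K % 8 = 5)

include hWd h8

/-- **At `2` inert (`d_K ≡ 5 mod 8`) and multiplicative, the two Tamagawa exponents add up to at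
most `ord_p(ord_2 Δ_min(E))`, for every ODD `p`** (`p = 3` included): exactly one of `E`, `E^{d_K}`
is split multiplicative at `2` (`twist_two_of_mod_eight`), both with `ord_2 Δ_min(E)`; the split one
has `c_2 = ord_2 Δ_min(E)` (Kodaira–Néron IV.9.2(d)), the non-split one `c_2 ∈ {1, 2}`, prime to
`p ≥ 3` (`padicValNat_localTamagawaNumber_eq_zero_of_mult`). The odd-prime companion of multr1-p2's
`padicValNat_localTamagawaNumber_add_twist_le_of_inert_two` (`p ≥ 5`).
[cite: SilvermanATAEC1994, Cor. IV.9.2(d) with (b) (PDF p. 340) and IV.9.4 Step 2 (PDF p. 344)]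
[cite: SilvermanAEC2009, VII.5 Prop. 5.1(b) and App. A Prop. A.1.1] -/
theorem padicValNat_localTamagawaNumber_add_twist_le_of_inert_two_odd (p : ℕ) [Fact p.Prime]
    (hp2 : p ≠ 2) (hmult : Mult W 2) :
    padicValNat p ((W.baseChange ℚ_[2]).localTamagawaNumber ℤ_[2]) +
        padicValNat p ((Wd.baseChange ℚ_[2]).localTamagawaNumber ℤ_[2]) ≤
      padicValNat p (padicValInt 2 W.minimalDiscriminantInt) := by
  have hp3 : 3 ≤ p := by
    have := (Fact.out : p.Prime).two_le
    omega
  obtain ⟨hΔ, h⟩ := twist_two_of_mod_eight W K Cd hWd h8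
  obtain ⟨hmultd, hswap⟩ := h hmult
  obtain ⟨v, hv⟩ : ∃ v : HeightOneSpectrum ℤ, (primesEquiv v : ℕ) = 2 :=
    ⟨primesEquiv.symm ⟨2, Nat.prime_two⟩, by rw [Equiv.apply_symm_apply]⟩
  by_cases hWs : W.HasSplitMultiplicativeReductionAtPrime 2
  · have hWdns : ¬ Wd.HasSplitMultiplicativeReductionAtPrime 2 := fun hs ↦ (hswap.mp hs) hWs
    rw [padicValNat_localTamagawaNumber_eq_zero_of_mult Wd p 2 hp3 hmultd (Or.inl hWdns), add_zero,
      localTamagawaNumber_eq_padicValInt_of_split W v hv hWs]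
  · have hWds : Wd.HasSplitMultiplicativeReductionAtPrime 2 := hswap.mpr hWs
    rw [padicValNat_localTamagawaNumber_eq_zero_of_mult W p 2 hp3 hmult (Or.inl hWs), zero_add,
      localTamagawaNumber_eq_padicValInt_of_split Wd v hv hWds, hΔ]

end InertTwo

end Summit.BirchSwinnertonDyer.Rank1Residual.X11b.Three

end
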